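import Literature.NumberTheory.EllipticCurves.Rank1Residual.Typed.HigherDescentCertificate
import Literature.NumberTheory.EllipticCurves.SelmerGroupCardinality
import HarnessLib

/-!
# Higher-descent certificates in Selmer currency, any rank: `#Sel^(n)`, `rank`, `#E(K)[n]` ⇒ `#Ш[n]` (cell `b2b-bsdres`)

HONEST FRAMING (run/shared/lean/b2b/bsd-rank1-residual/, verbatim): the goal of the cell is to
DELETE the COMBINATION-SHAPED residual classes for ALL analytic-rank `≤ 1` elliptic curves over `ℚ`
— "full BSD formula for every rank `≤ 1` curve in class C" assembled STRICTLY from published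
theorems — so that the rank-`≤ 1` remainder becomes exactly the CONSTRUCTION-SHAPED classes, which
are TYPED (missing-input `Prop`s), NOT attempted. This is not "finishing BSD".

Theorems only (no definition, no named fact). Companion of `Typed/HigherDescentCertificate.lean`
(the certificate lines `Ш[p^(k+1)] = Ш[p^k]`, `#Ш[p^k] = p^m` ⇒ `ord_p #Ш = m`, and the Selmer
dictionary in the special case `E(K)` finite of order prime to `n`) and of
`SelmerGroupCardinality.lean` (the descent count
`#Sel^(n)(E/K) = n ^ rank E(K) · #E(K)[n] · #Ш(E/K)[n]`, PROVED from Silverman X.4.2 +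
Mordell–Weil).

**What this file records.** A complete `n`-descent outputs `#Sel^(n)(E/K)`; with the rank (at the
cell's pairs `= r_an`, Gross–Zagier–Kolyvagin, bsd.S17, binder `hGZK`) and the rational `n`-torsion
`#E(K)[n]` this is `#Ш(E/K)[n]` (`card_torsionBy_sha_eq_of_card_selmerGroup`) — the classical
reading "`#Sel^(2) = 2^{r+t+s}`, `#E(ℚ)[2] = 2^t`, `#Ш[2] = 2^s`" (Cremona, *Algorithms* §3.6). So
the sha-1 lane's T-2DESC closure at `p = 2` (SHA-CENSUS.md §1: three-engine `dim Sel₂`, known `r`,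
`t`, and `Ш[4] = Ш[2]` from the Cassels–Tate pairing / explicit `4`-descent) is, in the kernel,
`X5.bsdp_two_of_card_selmerTwo`: `r_an ≤ 1`, `#E(ℚ)[2] = 2^t`, `#Sel^(2)(E/ℚ) = 2^{r_an+t+s}`,
`Ш[4] = Ш[2]`, `ord₂ #Ш_an = s` ⇒ `BSD(E,2)` — for EVERY rank `≤ 1`, with or without rational
`2`-torsion (the rank-`0`, odd-torsion case was `X5.bsdp_two_of_card_selmer_four_eight`). The
general-level form `bsdp_of_card_selmer_stable` reads two consecutive descents
(`#Sel^(p^k)`, `#Sel^(p^(k+1))` with `#E(K)[p^k]`, `#E(K)[p^(k+1)]`): stabilisation is then the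
COUNT `#Ш[p^(k+1)] = #Ш[p^k]` (`sha_stable_of_card_eq`). Per curve; nothing about a class.

References: Silverman *AEC* X.4.2 [SilvermanAEC2009]; Cremona 1997 §3.6 [Cremona1997]; Cassels
1998 §1 [Cassels1998]; Miller 2011 Def. 1.1 [Miller2011LMS]; cell file
`b2b-bsdres-sha-1/SHA-CENSUS.md` §§1, 4.
-/

noncomputable section

open scoped Classical

open WeierstrassCurve Literature.NumberTheory.EllipticCurves
  Literature.NumberTheory.EllipticCurves.Rank1Residual

namespace Literature.NumberTheory.EllipticCurves.Rank1Residual.Typed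

/-! ### Any number field: `#Ш[n]` from the descent count -/

section General

variable {K : Type*} [Field K] [NumberField K] (W : WeierstrassCurve K) [W.IsElliptic]

/-- **`#Ш(E/K)[n]` from a complete `n`-descent**: if `n ^ rank E(K) · #E(K)[n] = a` and
`#Sel^(n)(E/K) = a · c`, then the intrinsic `n`-torsion of `Ш(E/K)` has order `c`
(`card_selmerGroup_eq_pow_rank_mul` and cancellation of the positive factor `a`).
[cite: SilvermanAEC2009, Thm X.4.2(a)] [cite: Cremona1997, §3.6] -/
theorem card_torsionBy_sha_eq_of_card_selmerGroup (n : ℕ) [NeZero n] {a c : ℕ}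
    (ha : n ^ W.mordellWeilRank * Nat.card (AddSubgroup.torsionBy W.toAffine.Point n) = a)
    (hapos : 0 < a) (hSel : Nat.card (W.selmerGroup (n : ℤ)) = a * c) :
    Nat.card (AddSubgroup.torsionBy W.sha (n : ℕ)) = c := by
  have h := card_selmerGroup_eq_pow_rank_mul W n
  rw [hSel, ha] at h
  rw [card_torsionBy_sha_eq_card_inf]
  exact (Nat.eq_of_mul_eq_mul_left hapos h).symm

/-- **Stabilisation from two consecutive descents**: for finite `Ш(E/K)`, if
`#Sel^(p^k) = a · c`, `#Sel^(p^(k+1)) = a' · c` with `a = p^{k·rank} · #E(K)[p^k]`,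
`a' = p^{(k+1)·rank} · #E(K)[p^(k+1)]` (so `#Ш[p^k] = #Ш[p^(k+1)] = c`), then
`Ш[p^(k+1)] = Ш[p^k]`. [cite: SilvermanAEC2009, Thm X.4.2(a)] -/
theorem sha_stable_of_card_selmerGroup (p k : ℕ) [NeZero p] (hfin : W.ShaFinite) {a a' c : ℕ}
    (ha : (p ^ k) ^ W.mordellWeilRank *
      Nat.card (AddSubgroup.torsionBy W.toAffine.Point (p ^ k : ℕ)) = a)
    (ha' : (p ^ (k + 1)) ^ W.mordellWeilRank *
      Nat.card (AddSubgroup.torsionBy W.toAffine.Point (p ^ (k + 1) : ℕ)) = a')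
    (hapos : 0 < a) (ha'pos : 0 < a')
    (hSel : Nat.card (W.selmerGroup ((p ^ k : ℕ) : ℤ)) = a * c)
    (hSel' : Nat.card (W.selmerGroup ((p ^ (k + 1) : ℕ) : ℤ)) = a' * c) :
    ∀ x : W.sha, p ^ (k + 1) • x = 0 → p ^ k • x = 0 := by
  haveI : NeZero (p ^ k) := ⟨pow_ne_zero _ (NeZero.ne p)⟩
  haveI : NeZero (p ^ (k + 1)) := ⟨pow_ne_zero _ (NeZero.ne p)⟩
  have h1 := card_torsionBy_sha_eq_of_card_selmerGroup W (p ^ k) ha hapos hSel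
  have h2 := card_torsionBy_sha_eq_of_card_selmerGroup W (p ^ (k + 1)) ha' ha'pos hSel'
  exact sha_stable_of_card_eq W p hfin (by rw [h1, h2])

end General

/-! ### Over `ℚ`: `BSD(E,p)` / `BSD(E,2)` from descent counts -/

section OverQ

variable (W : WeierstrassCurve ℚ) [W.IsElliptic] (p : ℕ) [hp : Fact p.Prime]

/-- **`BSD(E,p)` in analytic rank `≤ 1` from one complete `p^k`-descent plus stabilisation**
(class-free): GZK (`hGZK`) gives `rank = r_an` and `Ш` finite; `#E(ℚ)[p^k] = b` and
`#Sel^(p^k)(E/ℚ) = p^{k·r_an} · b · p^m` give `#Ш[p^k] = p^m`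
(`card_torsionBy_sha_eq_of_card_selmerGroup`); with `Ш[p^(k+1)] = Ш[p^k]` and `ord_p #Ш_an = m`
this is Miller's `BSD(E,p)` (`bsdp_of_stable`). Per curve; not a class theorem.
[cite: Miller2011LMS, §1 and Def. 1.1] [cite: SilvermanAEC2009, Thm X.4.2(a)] -/
theorem bsdp_of_card_selmer_stable (hGZK : rank_eq_analyticRank_of_analyticRank_le_one)
    (hr : W.analyticRank ≤ 1) {k m b : ℕ}
    (htors : Nat.card (AddSubgroup.torsionBy W.toAffine.Point (p ^ k : ℕ)) = b) (hb : 0 < b)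
    (hSel : Nat.card (W.selmerGroup ((p ^ k : ℕ) : ℤ)) = (p ^ k) ^ W.analyticRank * b * p ^ m)
    (hstab : ∀ x : W.sha, p ^ (k + 1) • x = 0 → p ^ k • x = 0)
    {q : ℚ} (hq : shaAn W = (q : ℂ)) (hv : padicValRat p q = m) : BSDp W p := by
  -- transport the computable `DecidableEq ℚ` of the binder to the classical one of the general
  -- theorems (as in `Typed/SelmerCardCertificate.lean`)
  have hinst : (instDecidableEqRat : DecidableEq ℚ) = fun a b => Classical.propDecidable (a = b) :=
    Subsingleton.elim _ _
  rw [hinst] at htors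
  haveI : NeZero (p ^ k) := ⟨pow_ne_zero _ hp.out.ne_zero⟩
  have hrank : W.mordellWeilRank = W.analyticRank := (hGZK W hr).1
  have hapos : 0 < (p ^ k) ^ W.analyticRank * b :=
    Nat.mul_pos (pow_pos (pow_pos hp.out.pos k) _) hb
  have hcard : Nat.card (AddSubgroup.torsionBy W.sha (p ^ k : ℕ)) = p ^ m :=
    card_torsionBy_sha_eq_of_card_selmerGroup W (p ^ k) (a := (p ^ k) ^ W.analyticRank * b)
      (by rw [hrank, htors]) hapos hSel
  exact bsdp_of_stable W p hGZK hr hstab hcard hq hv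

variable [W.IsGloballyMinimal]

omit hp in
/-- **X5 / T-2DESC in Selmer currency, any rank `≤ 1` ⇒ `BSD(E,2)`**: analytic rank `≤ 1` (GZK
`hGZK`: `rank = r_an`, `Ш` finite), `#E(ℚ)[2] = 2^t`, the complete `2`-descent
`#Sel^(2)(E/ℚ) = 2^{r_an + t + s}`, stabilisation `Ш[4] = Ш[2]` (Cassels–Tate pairing on `Sel^(2)`
non-degenerate on `Ш[2]`, equivalently every fake `4`-Selmer set outside the image of `E(ℚ)`
empty) and `ord₂ #Ш_an = s` give `BSD(E,2)` — the lane's closure shape for all sharp curves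
(SHA-CENSUS.md §1/§4), now with rational `2`-torsion and rank `1` allowed. Per curve; not a class
theorem. [cite: Cremona1997, §3.6] [cite: Cassels1998, §1] [cite: Miller2011LMS, §1 and Def. 1.1] -/
theorem X5.bsdp_two_of_card_selmerTwo (hGZK : rank_eq_analyticRank_of_analyticRank_le_one)
    (hr : W.analyticRank ≤ 1) {t s : ℕ}
    (ht : Nat.card (AddSubgroup.torsionBy W.toAffine.Point 2) = 2 ^ t)
    (hSel : Nat.card (W.selmerGroup 2) = 2 ^ (W.analyticRank + t + s))
    (hstab : ∀ x : W.sha, 4 • x = 0 → 2 • x = 0)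
    {q : ℚ} (hq : shaAn W = (q : ℂ)) (hv : padicValRat 2 q = s) : BSDp W 2 := by
  -- `E(ℚ)`'s group law (`Affine.Point.instAddCommGroup`) takes a `DecidableEq ℚ`; the general
  -- theorems carry the classical instance, this binder the computable one: transport along
  -- `Subsingleton.elim` (as in `Typed/SelmerCardCertificate.lean`).
  have hinst : (instDecidableEqRat : DecidableEq ℚ) = fun a b => Classical.propDecidable (a = b) :=
    Subsingleton.elim _ _
  rw [hinst] at ht
  have hrank : W.mordellWeilRank = W.analyticRank := (hGZK W hr).1
  have h := card_selmerGroup_eq_pow_rank_mul W 2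
  simp only [Nat.cast_ofNat] at h
  rw [hrank, ht, hSel, pow_add, pow_add] at h
  have hpos : 0 < 2 ^ W.analyticRank * 2 ^ t := by positivity
  have hsha : Nat.card (W.sha ⊓ AddSubgroup.torsionBy W.galH1 2 : AddSubgroup W.galH1) = 2 ^ s :=
    (Nat.eq_of_mul_eq_mul_left hpos h).symm
  have hsha' : Nat.card (AddSubgroup.torsionBy W.sha 2) = 2 ^ s := by
    have e := card_torsionBy_sha_eq_card_inf W 2
    simp only [Nat.cast_ofNat] at e
    rw [e, hsha]
  exact X5.bsdp_two_of_sha_four_eq_sha_two W hGZK hr hstab hsha' hq hv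

end OverQ

end Literature.NumberTheory.EllipticCurves.Rank1Residual.Typed

end
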